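import Literature.Analysis.FluidPDE.SereginEpsilonRegularityHolds
import Literature.Analysis.FluidPDE.LocalTypeISlabProfile
import Literature.Analysis.FluidPDE.LocalTypeIReverseTools
import Summits.NavierStokesRegularity.NavierStokesRegularity.Theorems.AdaptedFrequencyFrequencyRigidityClassicalSuitableSlab
import HarnessLib

/-!
# Crux `FrequencyRigidity` (stmt-NavierStokesRegularity-2955), line `scaled-energy-split`:
# the small-scaled-energy gap

Helper file (`--supports stmt-NavierStokesRegularity-2955`; theorems only, sorry-free).  Stub
`stub_smallScaledEnergyRegular`, the "small scaled energy gap" of Stub 2 of the line: there is an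
absolute `ε > 0` such that every classical solution `(u, p)` of the unforced unit-viscosity
Navier–Stokes system on `(−∞, 0) × ℝ³` whose Albritton–Barker quantity
`𝐈 = 𝐈(ℝ³ × ℝ₋)` (`typeIBound (Iio 0 ×ˢ univ) u p ∇u`, the supremum of `A + C + D + E` over all
backward parabolic balls of the lower half space) is `< ε` is NOT backward-singular at the
space–time origin (`¬ IsBackwardSingularPoint u 0`).

Proof.  Take `ε` from Seregin's backward ε-regularity criterion (Seregin 2014, Ch. 6, Thm. 1.4,
the tree theorem `seregin2014_thm14_holds`): a suitable weak solution `(v, q)` in the unit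
parabolic ball `Q = Q(0, 1)` (Albritton–Barker's class, `IsSuitableWeakSolutionInBall 1 0`) with
`sup_{0<r<1} E(r) < ε`, `E(r) = r⁻¹ ∫_{Q(r)} |∇v|²`, is essentially bounded on some `Q(ϱ)`,
`0 < ϱ < 1`.  Suppose the origin were backward-singular.  A classical solution on the slab is
suitable there with weak gradient `∇u` (`stub_classicalSuitableSlab`), and with `𝐈 < ∞` and a
singular origin the packaging `isLocalTypeISingularPoint_of_slabProfile` puts `(u, p − [p]_{B(0,1)})`
in A–B's class on `Q(0, 1)`.  Since `E(r) ≤ (A + C + D + E)(Q(0, r)) ≤ 𝐈 < ε` for every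
`r ∈ (0, 1)` (`cknE_le_abScaledSum`, `abScaledSum_le_typeIBound`; `E` does not involve the
pressure), Seregin's theorem bounds `u` on some `Q(0, ϱ)` — contradicting singularity.

## References

* G. Seregin, *Lecture Notes on Regularity Theory for the Navier–Stokes Equations*, World
  Scientific (2014), Ch. 6, §6.1, Thm. 1.4. [Seregin2014]
* D. Albritton, T. Barker, *On local Type I singularities of the Navier–Stokes equations and
  Liouville theorems*, J. Math. Fluid Mech. 21 (2019), §1 (the quantities `A, C, D, E, 𝐈(ω)`,
  singular points), Def. 2.1. [AlbrittonBarker2019]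
* L. Caffarelli, R. Kohn, L. Nirenberg, *Partial regularity of suitable weak solutions of the
  Navier–Stokes equations*, Comm. Pure Appl. Math. 35 (1982), Prop. 2. [CaffarelliKohnNirenberg1982]
-/

noncomputable section

-- the registered stub namespace repeats the summit name `NavierStokesRegularity` (summit = problem)
set_option linter.dupNamespace false

namespace Summit.NavierStokesRegularity.NavierStokesRegularity.Theorems.FrequencyRigidity.ScaledEnergySplit

open Literature.Analysis.FluidPDE MeasureTheory Set Filter Topology Function Metric
open scoped ENNReal NNReal

variable {u : ℝ → EuclideanSpace ℝ (Fin 3) → EuclideanSpace ℝ (Fin 3)}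
  {p : ℝ → EuclideanSpace ℝ (Fin 3) → ℝ}
  {G : ℝ → EuclideanSpace ℝ (Fin 3) → EuclideanSpace ℝ (Fin 3) →L[ℝ] EuclideanSpace ℝ (Fin 3)}

/-! ## `sup_{0<r<1} E(r) ≤ 𝐈(ℝ³ × ℝ₋)` -/

/-- Each `E(Q(0, r))`, `r > 0`, is at most `𝐈(ℝ³ × ℝ₋)`: the ball `Q(0, r)` is admissible
(`parabolicCylinder_subset_lowerHalf`) and `E ≤ A + C + D + E`.
[cite: AlbrittonBarker2019, §1 (display defining 𝐈(ω) after Thm 1.1)] -/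
theorem smallEnergy_cknE_le_typeIBound {r : ℝ} (hr : 0 < r) :
    cknE r (0 : ℝ × EuclideanSpace ℝ (Fin 3)) G ≤ typeIBound (Iio (0 : ℝ) ×ˢ univ) u p G :=
  cknE_le_abScaledSum.trans
    (abScaledSum_le_typeIBound hr (parabolicCylinder_subset_lowerHalf le_rfl r))

/-- Hence Seregin's multi-scale dissipation `sup_{0<r<1} E(r)` at the vertex of the unit ball is
at most `𝐈(ℝ³ × ℝ₋)`. [folklore] -/
theorem smallEnergy_iSup_cknE_le_typeIBound :
    (⨆ r ∈ Ioo (0 : ℝ) 1, cknE r (0 : ℝ × EuclideanSpace ℝ (Fin 3)) G) ≤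
      typeIBound (Iio (0 : ℝ) ×ˢ univ) u p G :=
  iSup₂_le fun _ hr => smallEnergy_cknE_le_typeIBound hr.1

/-! ## The stub -/

/-- **Stub `stub_smallScaledEnergyRegular` (small-scaled-energy gap of the line
`scaled-energy-split`).** There is an absolute `ε > 0` such that a classical solution of the
unforced unit-viscosity Navier–Stokes system on `(−∞, 0) × ℝ³` with Albritton–Barker quantity
`𝐈(ℝ³ × ℝ₋) < ε` is not backward-singular at the space–time origin: otherwise
`(u, p − [p]_{B(0,1)})` is a suitable weak solution in the unit parabolic ball in A–B's class
(`stub_classicalSuitableSlab`, `isLocalTypeISingularPoint_of_slabProfile`) with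
`sup_{0<r<1} E(r) ≤ 𝐈 < ε`, and Seregin's backward ε-regularity criterion
(`seregin2014_thm14_holds`) bounds `u` on some `Q(0, ϱ)`, contradicting singularity.
[cite: Seregin2014, Ch. 6 §6.1 Theorem 1.4, PDF p. 94] -/
theorem stub_smallScaledEnergyRegular : ∃ ε : ℝ, 0 < ε ∧ ∀ (u : ℝ → EuclideanSpace ℝ (Fin 3) → EuclideanSpace ℝ (Fin 3)) (p : ℝ → EuclideanSpace ℝ (Fin 3) → ℝ), Literature.Analysis.FluidPDE.IsClassicalNSSolutionOn (Set.Iio 0) 1 0 u p → Literature.Analysis.FluidPDE.typeIBound (Set.Iio (0:ℝ) ×ˢ Set.univ) u p (fun t x => fderiv ℝ (u t) x) < ENNReal.ofReal ε → ¬ Literature.Analysis.FluidPDE.IsBackwardSingularPoint u 0 := by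
  obtain ⟨ε, hε, hS⟩ := seregin2014_thm14_holds
  refine ⟨ε, hε, fun u p hsol hI hsing => ?_⟩
  -- classical ⇒ suitable on the slab, with weak gradient `∇u`
  obtain ⟨hsw, hwg⟩ := stub_classicalSuitableSlab u p hsol
  -- `𝐈 < ∞` and a singular origin: A–B's class in the unit ball, pressure gauged by its mean
  have hloc := isLocalTypeISingularPoint_of_slabProfile hsw hwg (hI.trans_le le_top) hsing
  obtain ⟨-, hball, -, -⟩ := hloc
  -- the weak gradient `∇u` on the unit ball and the smallness of `sup E(r)`
  have hwgQ : HasWeakSpatialGradientOn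
      (parabolicCylinderOpens 1 (0 : ℝ × EuclideanSpace ℝ (Fin 3))) u
      (fun t x => fderiv ℝ (u t) x) :=
    hwg.mono (parabolicCylinderOpens_le_slab 1 le_rfl)
  have hE : (⨆ r ∈ Ioo (0 : ℝ) 1,
      cknE r (0 : ℝ × EuclideanSpace ℝ (Fin 3)) (fun t x => fderiv ℝ (u t) x)) <
        ENNReal.ofReal ε :=
    smallEnergy_iSup_cknE_le_typeIBound.trans_lt hI
  -- Seregin: `u` is bounded on some `Q(0, ϱ)`
  obtain ⟨ϱ, hϱ, hfin⟩ := hS u _ hball ⟨_, hwgQ, hE⟩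
  exact hfin.ne (hsing ϱ hϱ.1)

end Summit.NavierStokesRegularity.NavierStokesRegularity.Theorems.FrequencyRigidity.ScaledEnergySplit
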